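/-
Copyright (c) 2026 the pub-hodgecm-mathlib formalisation cell (harness21).  Prover seat hodgecm-mathlib-K2E4-p11 (g5), Track B ∕ K2-LIT, h413 =
`stmt-HodgeConjecture-24833`, line `K2_E1_TraceFormulaBeta`, campaign «EIS-R7-BL-SPH-2», road card `ROADCARD-BL-SPH-3` §1 (P5)(c′) = P5c FILE B (dealer K2E1-plan (g5)
2026-09-04T09:11:29Z ∕ 09:17:24Z; census ∕ heads 09:25Z): A SMOOTH good spherical test function — a `GL_N(𝔸_E)` TEST FUNCTION `η` (`IsTestFunctionGL`, the class K1∕K2∕P6 carry as the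
binder `hη`), `η ≥ 0`, bi-`K_GL`-invariant (so bi-`K_U`-invariant on `U(J_N)(𝔸_F)`), with `Re η̂(z₀) > 0`.
-/
import Summits.HodgeConjecture.HodgeConjecture.Theorems.K2E1SphericalHeckeGoodTestFunctionU2   -- ★ P5b p858749: the tube, `re_ofReal_cpow_of_pos`, `cos_pos_of_abs_le_one`; ★ P5a letters
import Summits.HodgeConjecture.HodgeConjecture.Theorems.K2E1SphericalTestFunctionGL           -- ★ P5c FILE A (this seat): the smooth bi-`K_GL`-invariant `GL_N(𝔸_E)` test function
import HarnessLib

/-!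
# h413 ∕ Track B «K2-LIT», «EIS-R7-BL-SPH-2» P5c FILE B — `K2E1SphericalHeckeSmoothTestFunctionU2`: a SMOOTH, non-negative, bi-`K`-invariant `GL_N(𝔸_E)` test function `η`
# with `Re η̂(z₀) = Re ∫_{U(J_N)(𝔸_F)} η(x) H(x)^{z₀} dμ(x) > 0`

Cell `pub/hodgecm-mathlib`, crux H413 = `stmt-HodgeConjecture-24833`, route `HCCMUnconditional`; dealer K2E1-plan (g5) (09:06:23Z (iii), 09:11:29Z, 09:17:24Z: «P5c: `∃ η, IsTestFunctionGL
2 L η ∧ bi-K_U-invariant ∧ 0 ≤ η ∧ η̂ z₀ ≠ 0` … K1-L², K2, P6 all carry `hη` binders until then»).  THEOREMS ONLY (no `def`, no `instance`, no `notation`, no named-fact hypothesis, no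
`sorry`); lane `--kind proof --supports stmt-HodgeConjecture-24833 --as helper` (count-neutral).
WHY A NEW CONSTRUCTION.  ★ P5b `exists_biInvariant_continuous_hasCompactSupport_re_integral_pos` averages a Urysohn bump over `K_U × K_U` ON `U(J_N)(𝔸_F)`: continuous, not
archimedean-smooth, and not a function on `GL_N(𝔸_E)` — whereas K1 (★ `K2E1TruncatedKernelDecayU2`) smooths with `η₀ : GL_N(𝔸_E) → ℝ`, `IsTestFunctionGL N E η₀`, pulled back along
`adelicVal`.  ★ FILE A supplies, for every bump `φ` at `0`, the `GL_N(𝔸_E)` test function `η_φ(g) = φ(Q(g_∞ᴴ − g_∞⁻¹))·𝟙[g_f ∈ GL_N(𝒪̂_E)]`: smooth, `≥ 0`, `η_φ(1) = 1`, bi-`K_GL`-invariant,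
with `{Q(xᴴ − x⁻¹) ≤ r}` compact and `Q(xᴴ − x⁻¹) = 0 ⟹ x ∈ K_∞`.  NON-VANISHING HERE: the compact sets `T_r = {x ∈ U(J_N)(𝔸_F) : Q((val x)_∞ᴴ − (val x)_∞⁻¹) ≤ r, (val x)_f ∈ GL_N(𝒪̂_E)}`
decrease to `K_U`, so one of them lies in the open tube `K_U·V` of ★ P5b §3 on which `|Im z₀ · log H| < 1` (Mathlib `exists_subset_nhds_of_isCompact'`); with `φ.rOut = r`,
`Re H(x)^{z₀} = H(x)^{Re z₀} cos(Im z₀ log H(x)) > 0` wherever `η(val x) ≠ 0`, and ★ P5b §4's positivity argument applies verbatim.  (Langlands 1976 §6 p. 167; Mœglin–Waldspurger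
II.1.2; Bernstein–Lapid §4, the spherical «HC-lemma»: `δ(f)` with `f̂(z₀) ≠ 0`, `f ∈ C_c^∞` bi-`K`-invariant.)
* HEAD **`exists_isTestFunctionGL_biInvariant_re_integral_pos (μ) (z₀)`** and `…_integral_ne_zero` — in ★ P5b's letters, for every quasi-split `U(J_N)` of `E∕F`.
NOT INCLUDED (honest): `(η ∗ η)^ = η̂²` (= ★ P5a (b) twice, taken at the consumer by the 09:04:47Z ruling) and a `z₀`-uniform `η` (not to be had: `η̂` is entire and non-constant).
HONEST LABEL.  Count-neutral helper; proves no printed statement; HC_CM is proved only modulo the 7 printed citations (2 remaining named inputs: hLiu418 = `stmt-HodgeConjecture-24832`,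
h413 = `stmt-HodgeConjecture-24833`) until rung 0 closes.

## References
* [Langlands1976] R. P. Langlands, *On the Functional Equations Satisfied by Eisenstein Series*, LNM 544 (1976), §6 p. 167.
* [MoeglinWaldspurger1995] C. Mœglin, J.-L. Waldspurger, *Spectral Decomposition and Eisenstein Series* (1995), II.1.2.
* [BernsteinLapid2019] J. Bernstein, E. Lapid, *On the meromorphic continuation of Eisenstein series*, J. AMS 37 (2024), §4.
-/

set_option autoImplicit false
set_option linter.dupNamespace false  -- the mandated namespace repeats the summit's segment (`HodgeConjecture.HodgeConjecture`)

noncomputable section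

open MeasureTheory Measure NumberField NumberField.mixedEmbedding IsDedekindDomain Set Filter Complex Topology
open scoped ENNReal NNReal MatrixGroups Matrix Classical Pointwise
open Literature.NumberTheory Literature.NumberTheory.Automorphic Literature.NumberTheory.Automorphic.UnitaryGroup
open AdelicGroupData
open Summit.HodgeConjecture.HodgeConjecture.Cruxes.H413.K2E1SphericalHeckeEigenSectionU2
open Summit.HodgeConjecture.HodgeConjecture.Cruxes.H413.K2E1SphericalHeckeGoodTestFunctionU2
open Summit.HodgeConjecture.HodgeConjecture.Cruxes.H413.K2E1HeightFunctionU3 (borelHeight_one)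
open Summit.HodgeConjecture.HodgeConjecture.Cruxes.H413.K2E1SphericalTestFunctionGL

namespace Summit.HodgeConjecture.HodgeConjecture.Cruxes.H413.K2E1SphericalHeckeSmoothTestFunctionU2

/-! ## §4 HEAD: on `U(J_N)(𝔸_F)` — bi-`K_U`-invariance and `Re η̂(z₀) > 0` -/

section Unitary

variable {F E : Type} [Field F] [NumberField F] [Field E] [NumberField E] [Algebra F E] {c : E ≃ₐ[F] E}
variable {N : ℕ} [NeZero N]
variable [MeasurableSpace (quasiSplit F E c N).Adelic] [BorelSpace (quasiSplit F E c N).Adelic]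

/-- **HEAD — A SMOOTH GOOD SPHERICAL TEST FUNCTION (P5c).**  Let `G = U(J_N)` be the quasi-split unitary group of `E∕F`, `μ` a measure on `G(𝔸_F)` finite on compacta and positive on
non-empty open sets (e.g. Haar), `z₀ : ℂ`.  There is a `GL_N(𝔸_E)` TEST FUNCTION `η` (★ `IsTestFunctionGL N E η`: continuous, compactly supported, archimedean-smooth, of finite level) with
`η ≥ 0`, `η(1) = 1`, BI-`K_GL`-INVARIANT (`η(κ₁ g κ₂) = η(g)`, `κᵢ ∈ K_GL = K_∞·GL_N(𝒪̂_E)`) — hence `x ↦ η(val x)` is bi-`K_U`-invariant on `G(𝔸_F)`, `K_U = val⁻¹(K_GL)` — and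
`Re η̂(z₀) = Re ∫ η(val x) H(x)^{z₀} dμ(x) > 0`.  Construction: `η(g) = φ(Q(g_∞ᴴ − g_∞⁻¹))·𝟙[g_f ∈ GL_N(𝒪̂_E)]` (§3) with the bump radius chosen by compactness so that the support of `η ∘ val`
lies in the tube `K_U·V` of ★ P5b §3 (`|Im z₀ · log H| < 1`), and then ★ P5b §4's positivity argument. [cite: Langlands1976, §6 p. 167] [cite: MoeglinWaldspurger1995, II.1.2]
[cite: BernsteinLapid2019, §4] -/
theorem exists_isTestFunctionGL_biInvariant_re_integral_pos (μ : Measure (quasiSplit F E c N).Adelic) [IsFiniteMeasureOnCompacts μ] [μ.IsOpenPosMeasure] (z₀ : ℂ) :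
    ∃ η : GL (Fin N) (AdeleRing (𝓞 E) E) → ℝ, IsTestFunctionGL N E η ∧ (∀ g, 0 ≤ η g) ∧ η 1 = 1 ∧
      (∀ κ₁ ∈ standardMaximalCompactGL N E, ∀ κ₂ ∈ standardMaximalCompactGL N E, ∀ g, η (κ₁ * g * κ₂) = η g) ∧
      (∀ k₁ k₂ : (quasiSplit F E c N).Adelic, adelicVal F E c N ((StdForm.antidiagonal N).over E) k₁ ∈ standardMaximalCompactGL N E → adelicVal F E c N ((StdForm.antidiagonal N).over E) k₂ ∈ standardMaximalCompactGL N E →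
        ∀ x, η (adelicVal F E c N ((StdForm.antidiagonal N).over E) (k₁ * x * k₂)) = η (adelicVal F E c N ((StdForm.antidiagonal N).over E) x)) ∧
      0 < (∫ x, ((η (adelicVal F E c N ((StdForm.antidiagonal N).over E) x) : ℝ) : ℂ) * (((borelHeight x : ℝ≥0) : ℝ) : ℂ) ^ z₀ ∂μ).re := by
  haveI := t2Space_quasiSplitAdelic (F := F) (E := E) (c := c) (N := N)
  haveI := locallyCompactSpace_quasiSplitAdelic (F := F) (E := E) (c := c) (N := N)
  haveI := secondCountableTopology_quasiSplitAdelic (F := F) (E := E) (c := c) (N := N)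
  have hemb : IsClosedEmbedding (adelicVal F E c N ((StdForm.antidiagonal N).over E)) := (isClosed_adelic F E c N ((StdForm.antidiagonal N).over E)).isClosedEmbedding_subtypeVal
  set KU : Set (quasiSplit F E c N).Adelic :=
    (((standardMaximalCompactGL N E).comap (adelicVal F E c N ((StdForm.antidiagonal N).over E)) : Subgroup (quasiSplit F E c N).Adelic) : Set (quasiSplit F E c N).Adelic) with hKUdef
  -- (1) the tube `K_U · V` of ★ P5b §3, opened up
  obtain ⟨V, hV, hKV⟩ := exists_nhds_forall_abs_mul_log_borelHeight_lt (F := F) (E := E) (c := c) (N := N) z₀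
  set W : Set (quasiSplit F E c N).Adelic := KU * interior V with hWdef
  have hWo : IsOpen W := isOpen_interior.mul_left
  have hKW : KU ⊆ W := fun k hk => ⟨k, hk, 1, mem_interior_iff_mem_nhds.2 hV, mul_one k⟩
  -- (2) the compact sets `T_r = {D((val x)_∞) ≤ r, (val x)_f ∈ GL_N(𝒪̂_E)}` decrease to `K_U`
  set D : (quasiSplit F E c N).Adelic → ℝ := fun x => hsQ (((GLn.toMixed N E (adelicVal F E c N ((StdForm.antidiagonal N).over E) x) : GL (Fin N) (mixedSpace E)) : Matrix (Fin N) (Fin N) (mixedSpace E))ᴴ - (((GLn.toMixed N E (adelicVal F E c N ((StdForm.antidiagonal N).over E) x))⁻¹ : GL (Fin N) (mixedSpace E)) : Matrix (Fin N) (Fin N) (mixedSpace E))) with hDdef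
  have hDc : Continuous D := continuous_hsQ_defect.comp ((GLn.continuous_toMixed N E).comp hemb.continuous)
  have hsndc : Continuous fun x : (quasiSplit F E c N).Adelic => GLn.sndHom N E (adelicVal F E c N ((StdForm.antidiagonal N).over E) x) := (GLn.continuous_sndHom (n := N) (K := E)).comp hemb.continuous
  set T : {r : ℝ // 0 < r} → Set (quasiSplit F E c N).Adelic := fun r => {x | D x ≤ (r : ℝ) ∧ GLn.sndHom N E (adelicVal F E c N ((StdForm.antidiagonal N).over E) x) ∈ glFiniteIntegralLevel N E} with hTdef
  have hTclosed : ∀ r, IsClosed (T r) := fun r =>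
    (isClosed_le hDc continuous_const).inter (((glFiniteIntegralLevel N E).isClosed_of_isOpen (isOpen_glFiniteIntegralLevel N E)).preimage hsndc)
  have hTcpt : ∀ r, IsCompact (T r) := by
    intro r
    have hC : IsCompact ((GLn.ofInfinite N E '' {y : GL (Fin N) (mixedSpace E) | hsQ ((y : Matrix (Fin N) (Fin N) (mixedSpace E))ᴴ - ((y⁻¹ : GL (Fin N) (mixedSpace E)) : Matrix (Fin N) (Fin N) (mixedSpace E))) ≤ (r : ℝ)}) *
        (GLn.ofFinite N E '' (glFiniteIntegralLevel N E : Set (GL (Fin N) (FiniteAdeleRing (𝓞 E) E))))) :=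
      ((isCompact_setOf_hsQ_defect_le (n := N) (K := E) (r : ℝ)).image (GLn.continuous_ofInfinite N E)).mul
        ((isCompact_glFiniteIntegralLevel_holds N E).image (GLn.continuous_ofFinite N E))
    refine (hemb.isCompact_preimage hC).of_isClosed_subset (hTclosed r) fun x hx => ?_
    rw [Set.mem_preimage, ← GLn.ofInfinite_toMixed_mul_ofFinite_sndHom (adelicVal F E c N ((StdForm.antidiagonal N).over E) x)]
    exact Set.mul_mem_mul (Set.mem_image_of_mem _ hx.1) (Set.mem_image_of_mem _ hx.2)
  have hTdir : Directed (· ⊇ ·) T := by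
    intro r₁ r₂
    refine ⟨⟨min (r₁ : ℝ) r₂, lt_min r₁.2 r₂.2⟩, fun x hx => ⟨hx.1.trans (min_le_left _ _), hx.2⟩, fun x hx => ⟨hx.1.trans (min_le_right _ _), hx.2⟩⟩
  have hTint : ∀ x ∈ ⋂ r, T r, x ∈ KU := by
    intro x hx
    rw [Set.mem_iInter] at hx
    have hD0 : D x = 0 := by
      refine le_antisymm (le_of_forall_pos_le_add fun ε hε => ?_) (hsQ_nonneg _)
      have h := (hx ⟨ε, hε⟩).1
      rw [zero_add]
      exact h
    have hinf : GLn.toMixed N E (adelicVal F E c N ((StdForm.antidiagonal N).over E) x) ∈ Kinf N E := by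
      rw [Kinf_eq_unitarySubgroupGL, mem_unitarySubgroupGL_iff]
      exact star_mul_self_eq_one_of_hsQ_defect_eq_zero hD0
    exact Subgroup.mem_comap.2 ((mem_standardMaximalCompactGL_iff_toMixed_sndHom _).2 ⟨hinf, (hx ⟨1, one_pos⟩).2⟩)
  haveI : Nonempty {r : ℝ // 0 < r} := ⟨⟨1, one_pos⟩⟩
  obtain ⟨r, hr⟩ := exists_subset_nhds_of_isCompact' hTdir hTcpt hTclosed (U := W) fun x hx => hWo.mem_nhds (hKW (hTint x hx))
  -- (3) the test function with bump radius `r`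
  let φ : ContDiffBump (0 : ℝ) := ⟨(r : ℝ) / 2, r, half_pos r.2, half_lt_self r.2⟩
  have hφr : φ.rOut = (r : ℝ) := rfl
  set η : GL (Fin N) (AdeleRing (𝓞 E) E) → ℝ := fun g => adelicWeight (glFiniteIntegralLevel N E) (fun y : GL (Fin N) (mixedSpace E) => φ (hsQ ((y : Matrix (Fin N) (Fin N) (mixedSpace E))ᴴ - ((y⁻¹ : GL (Fin N) (mixedSpace E)) : Matrix (Fin N) (Fin N) (mixedSpace E))))) g with hηdef
  have hηt : IsTestFunctionGL N E η := isTestFunctionGL_sphericalWeight φ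
  have hη0 : ∀ g, 0 ≤ η g := fun g => sphericalWeight_nonneg φ g
  have hη1 : η 1 = 1 := sphericalWeight_one φ
  have hηK : ∀ κ₁ ∈ standardMaximalCompactGL N E, ∀ κ₂ ∈ standardMaximalCompactGL N E, ∀ g, η (κ₁ * g * κ₂) = η g :=
    fun κ₁ h₁ κ₂ h₂ g => sphericalWeight_mul_mul φ h₁ h₂ g
  have hηKU : ∀ k₁ k₂ : (quasiSplit F E c N).Adelic, adelicVal F E c N ((StdForm.antidiagonal N).over E) k₁ ∈ standardMaximalCompactGL N E → adelicVal F E c N ((StdForm.antidiagonal N).over E) k₂ ∈ standardMaximalCompactGL N E →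
      ∀ x, η (adelicVal F E c N ((StdForm.antidiagonal N).over E) (k₁ * x * k₂)) = η (adelicVal F E c N ((StdForm.antidiagonal N).over E) x) := fun k₁ k₂ h₁ h₂ x => by
    rw [map_mul, map_mul]; exact hηK _ h₁ _ h₂ _
  -- (4) wherever `η(val x) ≠ 0`, `x` lies in the tube: `|Im z₀ · log H(x)| < 1`
  have htube : ∀ x, η (adelicVal F E c N ((StdForm.antidiagonal N).over E) x) ≠ 0 → |z₀.im * Real.log ((borelHeight x : ℝ≥0) : ℝ)| < 1 := by
    intro x hx
    simp only [hηdef] at hx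
    rw [sphericalWeight_apply] at hx
    have hx1 := left_ne_zero_of_mul hx
    have hx2 : GLn.sndHom N E (adelicVal F E c N ((StdForm.antidiagonal N).over E) x) ∈ glFiniteIntegralLevel N E := by
      by_contra h2
      rw [if_neg h2, mul_zero] at hx
      exact hx rfl
    have hxT : x ∈ T r := ⟨(hφr ▸ hsQ_defect_lt_of_bump_ne_zero φ hx1).le, hx2⟩
    obtain ⟨k, hk, u, hu, rfl⟩ := hr hxT
    exact hKV k (Subgroup.mem_comap.1 hk) u (interior_subset hu)
  -- (5) positivity, as in ★ P5b §4, for `h := η ∘ val`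
  set h : (quasiSplit F E c N).Adelic → ℝ := fun x => η (adelicVal F E c N ((StdForm.antidiagonal N).over E) x) with hh
  have hhc : Continuous h := hηt.continuous.comp hemb.continuous
  have hhs : HasCompactSupport h := hηt.hasCompactSupport.comp_isClosedEmbedding hemb
  have hhnn : ∀ x, 0 ≤ h x := fun x => hη0 _
  set g : (quasiSplit F E c N).Adelic → ℝ := fun x =>
    h x * ((((borelHeight x : ℝ≥0) : ℝ) ^ z₀.re) * Real.cos (z₀.im * Real.log ((borelHeight x : ℝ≥0) : ℝ))) with hg
  have hgc : Continuous g :=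
    hhc.mul ((continuous_borelHeight_coe.rpow_const fun x => Or.inl (borelHeight_coe_pos x).ne').mul
      (Real.continuous_cos.comp (continuous_mul_log_borelHeight z₀)))
  have hgs : HasCompactSupport g := hhs.mul_right
  have hgnn : ∀ x, 0 ≤ g x := by
    intro x
    by_cases hx : h x = 0
    · simp only [hg, hx, zero_mul, le_refl]
    · exact mul_nonneg (hhnn x) (mul_nonneg (Real.rpow_nonneg (borelHeight_coe_pos x).le _)
        (cos_pos_of_abs_le_one (htube x hx).le).le)
  have hg1 : g 1 ≠ 0 := by
    have h1 : h 1 = 1 := by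
      show η (adelicVal F E c N ((StdForm.antidiagonal N).over E) 1) = 1
      rw [map_one]; exact hη1
    simp only [hg, h1, borelHeight_one, NNReal.coe_one, Real.one_rpow, Real.log_one, mul_zero, Real.cos_zero, mul_one]
    exact one_ne_zero
  have hpos : 0 < ∫ x, g x ∂μ := hgc.integral_pos_of_hasCompactSupport_nonneg_nonzero hgs hgnn hg1
  have hint : Integrable (fun x => (h x : ℂ) * (((borelHeight x : ℝ≥0) : ℝ) : ℂ) ^ z₀) μ :=
    (continuous_mul_borelHeight_cpow (continuous_ofReal.comp hhc) z₀).integrable_of_hasCompactSupport ((hhs.comp_left ofReal_zero).mul_right)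
  have hre : (∫ x, (h x : ℂ) * (((borelHeight x : ℝ≥0) : ℝ) : ℂ) ^ z₀ ∂μ).re = ∫ x, g x ∂μ := by
    rw [← RCLike.re_to_complex, ← integral_re hint]
    refine integral_congr_ae (Eventually.of_forall fun x => ?_)
    simp only [RCLike.re_to_complex, re_ofReal_mul, re_ofReal_cpow_of_pos (borelHeight_coe_pos x), hg]
  refine ⟨η, hηt, hη0, hη1, hηK, hηKU, ?_⟩
  show 0 < (∫ x, (h x : ℂ) * (((borelHeight x : ℝ≥0) : ℝ) : ℂ) ^ z₀ ∂μ).re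
  rw [hre]
  exact hpos

/-- **P5c, short form**: a `GL_N(𝔸_E)` test function `η ≥ 0`, bi-`K_GL`-invariant, whose pull-back to `U(J_N)(𝔸_F)` is bi-`K_U`-invariant and has `η̂(z₀) = ∫ η(val x) H(x)^{z₀} dμ ≠ 0` — the
binders `hη`, «bi-`K_U`», «`η̂ z₀ ≠ 0`» that K1-L², K2 and P6 carry, DISCHARGED (per `z₀`). [cite: Langlands1976, §6 p. 167] [cite: BernsteinLapid2019, §4] -/
theorem exists_isTestFunctionGL_biInvariant_integral_ne_zero (μ : Measure (quasiSplit F E c N).Adelic) [IsFiniteMeasureOnCompacts μ] [μ.IsOpenPosMeasure] (z₀ : ℂ) :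
    ∃ η : GL (Fin N) (AdeleRing (𝓞 E) E) → ℝ, IsTestFunctionGL N E η ∧ (∀ g, 0 ≤ η g) ∧
      (∀ κ₁ ∈ standardMaximalCompactGL N E, ∀ κ₂ ∈ standardMaximalCompactGL N E, ∀ g, η (κ₁ * g * κ₂) = η g) ∧
      (∀ k₁ k₂ : (quasiSplit F E c N).Adelic, adelicVal F E c N ((StdForm.antidiagonal N).over E) k₁ ∈ standardMaximalCompactGL N E → adelicVal F E c N ((StdForm.antidiagonal N).over E) k₂ ∈ standardMaximalCompactGL N E →
        ∀ x, η (adelicVal F E c N ((StdForm.antidiagonal N).over E) (k₁ * x * k₂)) = η (adelicVal F E c N ((StdForm.antidiagonal N).over E) x)) ∧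
      (∫ x, ((η (adelicVal F E c N ((StdForm.antidiagonal N).over E) x) : ℝ) : ℂ) * (((borelHeight x : ℝ≥0) : ℝ) : ℂ) ^ z₀ ∂μ) ≠ 0 := by
  obtain ⟨η, hη, h0, -, hK, hKU, hre⟩ := exists_isTestFunctionGL_biInvariant_re_integral_pos (F := F) (E := E) (c := c) (N := N) μ z₀
  exact ⟨η, hη, h0, hK, hKU, fun h => hre.ne' (by rw [h, zero_re])⟩

/-! ## ED. 2 (dealer K2E1-plan (g5) 09:25:54Z «carry `η(g⁻¹) = η(g)` in the ∃-package»): the SYMMETRIC smooth good spherical test function -/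

/-- **HEAD, ED. 2 — THE SYMMETRIC SMOOTH GOOD SPHERICAL TEST FUNCTION**: as `exists_isTestFunctionGL_biInvariant_re_integral_pos`, and moreover `η(g⁻¹) = η(g)` for all `g ∈ GL_N(𝔸_E)`
(★ FILE A ED. 2 `sphericalWeight_inv`: the defect `Q(xᴴ − x⁻¹)` is inversion-symmetric and `GL_N(𝒪̂_E)⁻¹ = GL_N(𝒪̂_E)`) — so the test functions of record `h = η ∗ η = η^∨ ∗ η` are symmetric,
`h(g⁻¹) = h(g)`, `ĥ = η̂²`, as the self-adjointness of `δ(h)` in P6′ requires. [cite: Langlands1976, §6 p. 167] [cite: MoeglinWaldspurger1995, II.1.2] [cite: BernsteinLapid2019, §4] -/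
theorem exists_symm_isTestFunctionGL_biInvariant_re_integral_pos (μ : Measure (quasiSplit F E c N).Adelic) [IsFiniteMeasureOnCompacts μ] [μ.IsOpenPosMeasure] (z₀ : ℂ) :
    ∃ η : GL (Fin N) (AdeleRing (𝓞 E) E) → ℝ, IsTestFunctionGL N E η ∧ (∀ g, 0 ≤ η g) ∧ η 1 = 1 ∧ (∀ g, η g⁻¹ = η g) ∧
      (∀ κ₁ ∈ standardMaximalCompactGL N E, ∀ κ₂ ∈ standardMaximalCompactGL N E, ∀ g, η (κ₁ * g * κ₂) = η g) ∧
      (∀ k₁ k₂ : (quasiSplit F E c N).Adelic, adelicVal F E c N ((StdForm.antidiagonal N).over E) k₁ ∈ standardMaximalCompactGL N E → adelicVal F E c N ((StdForm.antidiagonal N).over E) k₂ ∈ standardMaximalCompactGL N E →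
        ∀ x, η (adelicVal F E c N ((StdForm.antidiagonal N).over E) (k₁ * x * k₂)) = η (adelicVal F E c N ((StdForm.antidiagonal N).over E) x)) ∧
      0 < (∫ x, ((η (adelicVal F E c N ((StdForm.antidiagonal N).over E) x) : ℝ) : ℂ) * (((borelHeight x : ℝ≥0) : ℝ) : ℂ) ^ z₀ ∂μ).re := by
  haveI := t2Space_quasiSplitAdelic (F := F) (E := E) (c := c) (N := N)
  haveI := locallyCompactSpace_quasiSplitAdelic (F := F) (E := E) (c := c) (N := N)
  haveI := secondCountableTopology_quasiSplitAdelic (F := F) (E := E) (c := c) (N := N)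
  have hemb : IsClosedEmbedding (adelicVal F E c N ((StdForm.antidiagonal N).over E)) := (isClosed_adelic F E c N ((StdForm.antidiagonal N).over E)).isClosedEmbedding_subtypeVal
  set KU : Set (quasiSplit F E c N).Adelic :=
    (((standardMaximalCompactGL N E).comap (adelicVal F E c N ((StdForm.antidiagonal N).over E)) : Subgroup (quasiSplit F E c N).Adelic) : Set (quasiSplit F E c N).Adelic) with hKUdef
  -- (1) the tube `K_U · V` of ★ P5b §3, opened up
  obtain ⟨V, hV, hKV⟩ := exists_nhds_forall_abs_mul_log_borelHeight_lt (F := F) (E := E) (c := c) (N := N) z₀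
  set W : Set (quasiSplit F E c N).Adelic := KU * interior V with hWdef
  have hWo : IsOpen W := isOpen_interior.mul_left
  have hKW : KU ⊆ W := fun k hk => ⟨k, hk, 1, mem_interior_iff_mem_nhds.2 hV, mul_one k⟩
  -- (2) the compact sets `T_r = {D((val x)_∞) ≤ r, (val x)_f ∈ GL_N(𝒪̂_E)}` decrease to `K_U`
  set D : (quasiSplit F E c N).Adelic → ℝ := fun x => hsQ (((GLn.toMixed N E (adelicVal F E c N ((StdForm.antidiagonal N).over E) x) : GL (Fin N) (mixedSpace E)) : Matrix (Fin N) (Fin N) (mixedSpace E))ᴴ - (((GLn.toMixed N E (adelicVal F E c N ((StdForm.antidiagonal N).over E) x))⁻¹ : GL (Fin N) (mixedSpace E)) : Matrix (Fin N) (Fin N) (mixedSpace E))) with hDdef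
  have hDc : Continuous D := continuous_hsQ_defect.comp ((GLn.continuous_toMixed N E).comp hemb.continuous)
  have hsndc : Continuous fun x : (quasiSplit F E c N).Adelic => GLn.sndHom N E (adelicVal F E c N ((StdForm.antidiagonal N).over E) x) := (GLn.continuous_sndHom (n := N) (K := E)).comp hemb.continuous
  set T : {r : ℝ // 0 < r} → Set (quasiSplit F E c N).Adelic := fun r => {x | D x ≤ (r : ℝ) ∧ GLn.sndHom N E (adelicVal F E c N ((StdForm.antidiagonal N).over E) x) ∈ glFiniteIntegralLevel N E} with hTdef
  have hTclosed : ∀ r, IsClosed (T r) := fun r =>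
    (isClosed_le hDc continuous_const).inter (((glFiniteIntegralLevel N E).isClosed_of_isOpen (isOpen_glFiniteIntegralLevel N E)).preimage hsndc)
  have hTcpt : ∀ r, IsCompact (T r) := by
    intro r
    have hC : IsCompact ((GLn.ofInfinite N E '' {y : GL (Fin N) (mixedSpace E) | hsQ ((y : Matrix (Fin N) (Fin N) (mixedSpace E))ᴴ - ((y⁻¹ : GL (Fin N) (mixedSpace E)) : Matrix (Fin N) (Fin N) (mixedSpace E))) ≤ (r : ℝ)}) *
        (GLn.ofFinite N E '' (glFiniteIntegralLevel N E : Set (GL (Fin N) (FiniteAdeleRing (𝓞 E) E))))) :=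
      ((isCompact_setOf_hsQ_defect_le (n := N) (K := E) (r : ℝ)).image (GLn.continuous_ofInfinite N E)).mul
        ((isCompact_glFiniteIntegralLevel_holds N E).image (GLn.continuous_ofFinite N E))
    refine (hemb.isCompact_preimage hC).of_isClosed_subset (hTclosed r) fun x hx => ?_
    rw [Set.mem_preimage, ← GLn.ofInfinite_toMixed_mul_ofFinite_sndHom (adelicVal F E c N ((StdForm.antidiagonal N).over E) x)]
    exact Set.mul_mem_mul (Set.mem_image_of_mem _ hx.1) (Set.mem_image_of_mem _ hx.2)
  have hTdir : Directed (· ⊇ ·) T := by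
    intro r₁ r₂
    refine ⟨⟨min (r₁ : ℝ) r₂, lt_min r₁.2 r₂.2⟩, fun x hx => ⟨hx.1.trans (min_le_left _ _), hx.2⟩, fun x hx => ⟨hx.1.trans (min_le_right _ _), hx.2⟩⟩
  have hTint : ∀ x ∈ ⋂ r, T r, x ∈ KU := by
    intro x hx
    rw [Set.mem_iInter] at hx
    have hD0 : D x = 0 := by
      refine le_antisymm (le_of_forall_pos_le_add fun ε hε => ?_) (hsQ_nonneg _)
      have h := (hx ⟨ε, hε⟩).1
      rw [zero_add]
      exact h
    have hinf : GLn.toMixed N E (adelicVal F E c N ((StdForm.antidiagonal N).over E) x) ∈ Kinf N E := by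
      rw [Kinf_eq_unitarySubgroupGL, mem_unitarySubgroupGL_iff]
      exact star_mul_self_eq_one_of_hsQ_defect_eq_zero hD0
    exact Subgroup.mem_comap.2 ((mem_standardMaximalCompactGL_iff_toMixed_sndHom _).2 ⟨hinf, (hx ⟨1, one_pos⟩).2⟩)
  haveI : Nonempty {r : ℝ // 0 < r} := ⟨⟨1, one_pos⟩⟩
  obtain ⟨r, hr⟩ := exists_subset_nhds_of_isCompact' hTdir hTcpt hTclosed (U := W) fun x hx => hWo.mem_nhds (hKW (hTint x hx))
  -- (3) the test function with bump radius `r`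
  let φ : ContDiffBump (0 : ℝ) := ⟨(r : ℝ) / 2, r, half_pos r.2, half_lt_self r.2⟩
  have hφr : φ.rOut = (r : ℝ) := rfl
  set η : GL (Fin N) (AdeleRing (𝓞 E) E) → ℝ := fun g => adelicWeight (glFiniteIntegralLevel N E) (fun y : GL (Fin N) (mixedSpace E) => φ (hsQ ((y : Matrix (Fin N) (Fin N) (mixedSpace E))ᴴ - ((y⁻¹ : GL (Fin N) (mixedSpace E)) : Matrix (Fin N) (Fin N) (mixedSpace E))))) g with hηdef
  have hηt : IsTestFunctionGL N E η := isTestFunctionGL_sphericalWeight φ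
  have hη0 : ∀ g, 0 ≤ η g := fun g => sphericalWeight_nonneg φ g
  have hη1 : η 1 = 1 := sphericalWeight_one φ
  have hηinv : ∀ g, η g⁻¹ = η g := fun g => sphericalWeight_inv φ g
  have hηK : ∀ κ₁ ∈ standardMaximalCompactGL N E, ∀ κ₂ ∈ standardMaximalCompactGL N E, ∀ g, η (κ₁ * g * κ₂) = η g :=
    fun κ₁ h₁ κ₂ h₂ g => sphericalWeight_mul_mul φ h₁ h₂ g
  have hηKU : ∀ k₁ k₂ : (quasiSplit F E c N).Adelic, adelicVal F E c N ((StdForm.antidiagonal N).over E) k₁ ∈ standardMaximalCompactGL N E → adelicVal F E c N ((StdForm.antidiagonal N).over E) k₂ ∈ standardMaximalCompactGL N E →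
      ∀ x, η (adelicVal F E c N ((StdForm.antidiagonal N).over E) (k₁ * x * k₂)) = η (adelicVal F E c N ((StdForm.antidiagonal N).over E) x) := fun k₁ k₂ h₁ h₂ x => by
    rw [map_mul, map_mul]; exact hηK _ h₁ _ h₂ _
  -- (4) wherever `η(val x) ≠ 0`, `x` lies in the tube: `|Im z₀ · log H(x)| < 1`
  have htube : ∀ x, η (adelicVal F E c N ((StdForm.antidiagonal N).over E) x) ≠ 0 → |z₀.im * Real.log ((borelHeight x : ℝ≥0) : ℝ)| < 1 := by
    intro x hx
    simp only [hηdef] at hx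
    rw [sphericalWeight_apply] at hx
    have hx1 := left_ne_zero_of_mul hx
    have hx2 : GLn.sndHom N E (adelicVal F E c N ((StdForm.antidiagonal N).over E) x) ∈ glFiniteIntegralLevel N E := by
      by_contra h2
      rw [if_neg h2, mul_zero] at hx
      exact hx rfl
    have hxT : x ∈ T r := ⟨(hφr ▸ hsQ_defect_lt_of_bump_ne_zero φ hx1).le, hx2⟩
    obtain ⟨k, hk, u, hu, rfl⟩ := hr hxT
    exact hKV k (Subgroup.mem_comap.1 hk) u (interior_subset hu)
  -- (5) positivity, as in ★ P5b §4, for `h := η ∘ val`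
  set h : (quasiSplit F E c N).Adelic → ℝ := fun x => η (adelicVal F E c N ((StdForm.antidiagonal N).over E) x) with hh
  have hhc : Continuous h := hηt.continuous.comp hemb.continuous
  have hhs : HasCompactSupport h := hηt.hasCompactSupport.comp_isClosedEmbedding hemb
  have hhnn : ∀ x, 0 ≤ h x := fun x => hη0 _
  set g : (quasiSplit F E c N).Adelic → ℝ := fun x =>
    h x * ((((borelHeight x : ℝ≥0) : ℝ) ^ z₀.re) * Real.cos (z₀.im * Real.log ((borelHeight x : ℝ≥0) : ℝ))) with hg
  have hgc : Continuous g :=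
    hhc.mul ((continuous_borelHeight_coe.rpow_const fun x => Or.inl (borelHeight_coe_pos x).ne').mul
      (Real.continuous_cos.comp (continuous_mul_log_borelHeight z₀)))
  have hgs : HasCompactSupport g := hhs.mul_right
  have hgnn : ∀ x, 0 ≤ g x := by
    intro x
    by_cases hx : h x = 0
    · simp only [hg, hx, zero_mul, le_refl]
    · exact mul_nonneg (hhnn x) (mul_nonneg (Real.rpow_nonneg (borelHeight_coe_pos x).le _)
        (cos_pos_of_abs_le_one (htube x hx).le).le)
  have hg1 : g 1 ≠ 0 := by
    have h1 : h 1 = 1 := by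
      show η (adelicVal F E c N ((StdForm.antidiagonal N).over E) 1) = 1
      rw [map_one]; exact hη1
    simp only [hg, h1, borelHeight_one, NNReal.coe_one, Real.one_rpow, Real.log_one, mul_zero, Real.cos_zero, mul_one]
    exact one_ne_zero
  have hpos : 0 < ∫ x, g x ∂μ := hgc.integral_pos_of_hasCompactSupport_nonneg_nonzero hgs hgnn hg1
  have hint : Integrable (fun x => (h x : ℂ) * (((borelHeight x : ℝ≥0) : ℝ) : ℂ) ^ z₀) μ :=
    (continuous_mul_borelHeight_cpow (continuous_ofReal.comp hhc) z₀).integrable_of_hasCompactSupport ((hhs.comp_left ofReal_zero).mul_right)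
  have hre : (∫ x, (h x : ℂ) * (((borelHeight x : ℝ≥0) : ℝ) : ℂ) ^ z₀ ∂μ).re = ∫ x, g x ∂μ := by
    rw [← RCLike.re_to_complex, ← integral_re hint]
    refine integral_congr_ae (Eventually.of_forall fun x => ?_)
    simp only [RCLike.re_to_complex, re_ofReal_mul, re_ofReal_cpow_of_pos (borelHeight_coe_pos x), hg]
  refine ⟨η, hηt, hη0, hη1, hηinv, hηK, hηKU, ?_⟩
  show 0 < (∫ x, (h x : ℂ) * (((borelHeight x : ℝ≥0) : ℝ) : ℂ) ^ z₀ ∂μ).re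
  rw [hre]
  exact hpos


/-- **ED. 2, short form**: a SYMMETRIC (`η(g⁻¹) = η g`), non-negative, bi-`K_GL`-invariant `GL_N(𝔸_E)` test function whose pull-back to `U(J_N)(𝔸_F)` is bi-`K_U`-invariant with `η̂(z₀) ≠ 0`.
[cite: Langlands1976, §6 p. 167] [cite: BernsteinLapid2019, §4] -/
theorem exists_symm_isTestFunctionGL_biInvariant_integral_ne_zero (μ : Measure (quasiSplit F E c N).Adelic) [IsFiniteMeasureOnCompacts μ] [μ.IsOpenPosMeasure] (z₀ : ℂ) :
    ∃ η : GL (Fin N) (AdeleRing (𝓞 E) E) → ℝ, IsTestFunctionGL N E η ∧ (∀ g, 0 ≤ η g) ∧ (∀ g, η g⁻¹ = η g) ∧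
      (∀ κ₁ ∈ standardMaximalCompactGL N E, ∀ κ₂ ∈ standardMaximalCompactGL N E, ∀ g, η (κ₁ * g * κ₂) = η g) ∧
      (∀ k₁ k₂ : (quasiSplit F E c N).Adelic, adelicVal F E c N ((StdForm.antidiagonal N).over E) k₁ ∈ standardMaximalCompactGL N E → adelicVal F E c N ((StdForm.antidiagonal N).over E) k₂ ∈ standardMaximalCompactGL N E →
        ∀ x, η (adelicVal F E c N ((StdForm.antidiagonal N).over E) (k₁ * x * k₂)) = η (adelicVal F E c N ((StdForm.antidiagonal N).over E) x)) ∧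
      (∫ x, ((η (adelicVal F E c N ((StdForm.antidiagonal N).over E) x) : ℝ) : ℂ) * (((borelHeight x : ℝ≥0) : ℝ) : ℂ) ^ z₀ ∂μ) ≠ 0 := by
  obtain ⟨η, hη, h0, -, hinv, hK, hKU, hre⟩ := exists_symm_isTestFunctionGL_biInvariant_re_integral_pos (F := F) (E := E) (c := c) (N := N) μ z₀
  exact ⟨η, hη, h0, hinv, hK, hKU, fun h => hre.ne' (by rw [h, zero_re])⟩

end Unitary

end Summit.HodgeConjecture.HodgeConjecture.Cruxes.H413.K2E1SphericalHeckeSmoothTestFunctionU2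

end
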